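import Summits.HodgeConjecture.HodgeConjecture.Theorems.HeckePrymWeilSemiregularSpreadOfBlochLifts
import Literature.AlgebraicGeometry.HodgeTheory.BlochSemiregularSpreadGlobal
import Literature.AlgebraicGeometry.HodgeTheory.ProperOverQuasiProjective
import Literature.AlgebraicGeometry.HodgeTheory.SupportedClassesSemipurity
import Literature.AlgebraicGeometry.HodgeTheory.FibreRestrictionsLocallyConstantRank
import Literature.AlgebraicGeometry.HodgeTheory.DirectImageBaseChangeSections
import Literature.AlgebraicGeometry.HodgeTheory.RegularImmersionCodim
import Literature.AlgebraicGeometry.HodgeTheory.RegularImmersionConormal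
import Literature.AlgebraicGeometry.Resolution.SmoothStalksRegular
import Literature.AlgebraicGeometry.Motives.GoodReductionSpecialFibreProofs
import HarnessLib

/-!
# Venture HSemireg — bridge (B1) with the OPENNESS half read at the OBJECT level, AS PRINTED in Bloch's proof of (7.4):
# (7.1) + Artin «`Z₀` lifts to an analytic family over `U`» ∧ Fulton «so `z_s` is algebraic for `s ∈ U`» ∧ Hilbert-scheme
# closedness ∧ «`U ⊂ T` ⟹ `T = S`» over the smooth CONNECTED base

HONEST FRAMING. Interface file of the computation cell `pub-hsemireg`, track «S4-PUSH» (iii), seat s4-bridge-1 (bridge (B1)).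
NOTHING about any explicit variety is asserted; nothing here says that HC, HC_CM or HC_AV is proved. THEOREMS ONLY: no `def`, no
named fact, no `sorry`, no new axiom; every published input is a hypothesis BY NAME.

## What this file adds

The tree types Bloch's (7.4) at the CLASS level as ONE named fact `BlochSemiregularSpread n p` (= Buchweitz–Flenner Thm. 5.2 at
`I = {p}`: hypotheses ⟹ «`z_s` algebraic for `s` in an open `U ∋ s₀`»), inside which sit THREE printed steps: (7.1) (formal lifting
of the semi-regular `Z₀`, (6.10)), the Hilbert-scheme `S̄`-point + «a theorem of Artin» (an analytic / étale family through `Z₀`),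
and «so `z_s` is algebraic for `s ∈ U`» (the fibres of the family are algebraic cycles whose classes are the flat transport of
`z₀`). The tree ALSO holds the first two steps as the OBJECT-level named fact `Bloch1972_semiregularSubschemeLifts`
(`BlochSemiregularityTheorem.lean`: an ÉTALE `π : V ⟶ S`, `v₀ ↦ s₀`, a closed `𝒵 ⊆ 𝒳 ×_S V` FLAT over `V` with fibre `Z₀`) and the
third as Fulton's flat-family cycle-class fact `fulton1998_flatFamily_cycleClass_specialises` (`FlatFamilyCycleClass.lean`,
Fulton 1998 Prop. 10.1 (a), Cor. 10.1, Lemma 19.1.1, Cor. 19.2 (b)); route HeckePrymWeil composed them into the class-level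
open-neighbourhood conclusion (`HeckePrymWeilLine.semiregularSpread_of_blochLifts_of_fulton`, kernel: rigidity of flat sections,
purity on the irreducible codimension-`p` fibre, descent along the open map `π`). HERE that composition is carried to the end of
Bloch's paragraph: + CLOSEDNESS (tree theorem `charlesSchnell_algebraicityLocus_iUnion_closed_holds`) + Baire over the smooth
CONNECTED base (connected ⟹ irreducible for a smooth `ℂ`-scheme: regular local rings are domains, Stacks 056S; Görtz–Wedhorn I
Ex. 3.16). Result: **(7.4) GLOBAL, as printed, modulo the OBJECT-level Bloch fact and Fulton's fact** — a finer provenance than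
`Bloch1972.theorem74{_connected}` (modulo the class-level `BlochSemiregularSpread`), with binders CLOSER to print: «`f` smooth and
PROJECTIVE» (a closed `S`-immersion into `ℙᴺ × S`), «`Z₀ ⊂ X₀` a local complete intersection of codimension `p`» (closed subscheme
of THE fibre `𝒳_{s₀}`, conormal sheaf finite locally free, codimension exactly `p`), «`g` smooth, connected».

* `Bloch1972.theorem74_connected_of_blochLifts_of_fulton` — the statement just described.
* `Bloch1972.theorem74_connected_of_blochLifts_of_fulton'` (v2, 2026-08-23) — THE SAME WITH TWO BINDERS DISCHARGED: (a) «`f`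
  projective in Hartshorne's sense» (`hproj`, a closed `S`-immersion `𝒳 ↪ ℙᴺ × S`) is now DERIVED from «`𝒳` quasi-projective, `f`
  proper» — a proper morphism out of a quasi-projective `ℂ`-scheme is projective (Hartshorne II §4; a proper monomorphism is a closed
  immersion, Stacks 04XV), tree theorem `IsQuasiProjectiveOver.exists_isClosedImmersion_projectiveSpace_tensor`
  (`Literature/…/HodgeTheory/ProperOverQuasiProjective.lean`); (b) «codimension EXACTLY `p`» (`hcohp`, a point of `Z₀` of codimension
  `p`) is now DISPENSED WITH: if every point of `Z₀` has codimension `> p`, then `W|_{X₀}`, supported on `Z₀`, lies in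
  `N^{p+1} H^{2p}(X₀) = 0` (semipurity of the coniveau filtration, Grothendieck 1969 §1 / Voisin I §11.1.2, tree theorem
  `supportedClasses_eq_bot_of_lt`), so the flat section `s ↦ W|_{𝒳_s}` vanishes on a neighbourhood of `s₀` (Ehresmann rigidity,
  `isOpen_setOf_map_fiberι_eq_zero`) where `0` is algebraic, and closedness + Baire finish as before. Net binder list of v2 =
  that of the class-level named fact `BlochSemiregularSpread n p` EXCEPT (i) the seed sits in THE fibre `𝒳_{s₀}` (no model
  isomorphism `e : X₀ ≅ 𝒳_{s₀}` — transporting `IsBlochSemiregular` along an isomorphism of ambient schemes is not in the tree) and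
  (ii) «lci» is rendered by `IsFiniteLocallyFree (conormalSheaf i₀)` (the object-level fact's rendering) rather than by
  `IsRegularImmersionOfCodim i₀ p` (the class-level fact's; Görtz–Wedhorn II Rem. 19.22 says the second implies the first — not in
  the tree); and v2 needs NO rationality of `W`. So (i) + (ii) are exactly what separates `Bloch1972_semiregularSubschemeLifts ∧
  fulton1998_flatFamily_cycleClass_specialises` from DISCHARGING `BlochSemiregularSpread n p` for integral seeds («exactly» rests
  on the route-side composition audit of the kernel, s4-ref VERDICT-B1-OBJECTLEVEL-s4-bridge-1-2026-08-23 §2; C-v2 verdict P-3).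
  v3 (2026-08-23): docstring words only — the printed (7.4) statement quotes restored in full («`z₀ ∈ H^{2p}_{DR}(X₀/ℂ)`»,
  «`z_s ∈ H^{2p}_{DR}(X_s/ℂ)`», s4-ref C-v2 R-1 = s4-bridge-lit O-1); statements and proofs byte-identical to v2.
* `Bloch1972.theorem74_connected_of_blochLifts_of_fulton''` (v4, 2026-08-23) — gap (ii) CLOSED: the lci seed is now given by
  the class-level fact's OWN predicate `IsRegularImmersionOfCodim i₀ p` (Görtz–Wedhorn II Def. 19.19/19.23: the ideal of `Z₀` is
  generated near each point by a weakly regular sequence of length `p`), from which the two binders of v2 are DERIVED by tree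
  theorems landed for this purpose: «conormal sheaf finite locally free» (`IsRegularImmersionOfCodim.isFiniteLocallyFree_conormalSheaf`,
  `RegularImmersionConormal.lean`: GW II Rem. 19.22, via Lech independence / Koszul `H₁ = 0`) and «codimension `≥ p` at every
  point» (`IsRegularImmersionOfCodim.le_coheight`, `RegularImmersionCodim.lean`: Bruns–Herzog Prop. 1.2.12/1.2.14), the fibre
  `X₀ = 𝒳_{s₀}` being locally Noetherian (smooth projective). Binder list of v4 = that of `BlochSemiregularSpread n p` EXCEPT
  ONLY (i) the model isomorphism `e : X₀ ≅ 𝒳_{s₀}` (and v4 needs no rationality of `W`); so (i) = transport of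
  `IsBlochSemiregular` along an isomorphism of ambient schemes is now THE ONLY thing separating
  `Bloch1972_semiregularSubschemeLifts ∧ fulton1998_flatFamily_cycleClass_specialises` from discharging `BlochSemiregularSpread n p`
  for integral seeds (binder-list comparison; the kernel's consumption audit is s4-ref's VERDICT-B1-OBJECTLEVEL §2).

Typed weaker-or-equal than print (named): `Z₀` INTEGRAL (print: any lci; the reducible case needs the componentwise class
hypothesis of the object-level fact and is route HeckePrymWeil's / `ComponentTransferUnion.lean`'s business); class level in the
conclusion («`z_s` is algebraic» = `∈ algebraicClasses`, the `ℂ`-span of cycle classes); «horizontal `z`» = a global class `W`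
with fibre restrictions of type `(p,p)` (NO rationality hypothesis needed on this path); quasi-projectivity of `𝒳`, `S` is the
standing hypothesis of the closedness theorem (Charles–Schnell §11.3.3). Typed STRONGER-or-equal than print in one hypothesis
(named, s4-ref VERDICT-B1-OBJECTLEVEL P-3): «`z₀` algebraic, representing `Z₀`» (print: `z₀ = [Z₀]`) is rendered as «`W|_{X₀}` is
SUPPORTED on `Z₀`» (`hsupp : … ∈ classesSupportedOn …`), which for the integral codimension-`p` `Z₀` means `W|_{X₀} = λ·[Z₀]` for
some `λ ∈ ℂ` (purity, Fulton 19.1.1) — `λ = 0` is the rigidity branch of the kernel, `λ ≠ 0` rescales; no new mathematical content.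

A second printed home of the same three-step arrow, for SHEAVES (the S4 lane's objects): Markman, ICM 2026 survey = arXiv:2509.23403
v2, p. 6 L59–66: Thm. 2.1 «[BF1, Th. 1.5] Let `E` be a semi-regular coherent sheaf over `Y₀`, such that `ch(E)` remains of Hodge type
over `B`. Then `E` extends to a coherent sheaf over `π⁻¹(U)` for some open analytic neighborhood `U` of `0` in `B`.» followed by «Assume
instead that the base `B` is a smooth and connected analytic space and the fibers of `π` are projective. The theorem then implies that
each class `ch_p(E)` remains algebraic over the whole of `B`, since the locus where it is algebraic is a countable union of Zariski
closed analytic subsets [Vo, Sec. 4.2], and it contains the non-empty open subset `U` over which `E` deforms.» (pin: lit-w-markman,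
cell bus l.9765; the sheaf-door analogue of the theorem below is `BuchweitzFlenner2003.semiregular_deforms_connected` in
`SemiregularityTheoremsConnected.lean`).

References: [Bloch1972Semiregularity] Thm. (7.1) p. 64, Thm. (7.4) p. 65 L9–14 and proof L15–22; [Artin1969] Cor. (2.2);
[Fulton1998] §10.1 Prop. 10.1 (a), Cor. 10.1, §19.1 Lemma 19.1.1, §19.2 Cor. 19.2 (b); [CharlesSchnell2014Notes] Prop. 11.3.11
(proof); [VoisinHodgeII2003] §3.1.2, §3.3.1; [Voisin2016HodgeConjectureSurvey] §4.2 Thm. 6 and the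
relative-Hilbert-scheme paragraph following it; [Nitsure2005] Thm. 5.1 and §1 (each `Hilb^{Φ,L}_{X/S}`, `Φ` a fixed Hilbert
polynomial, is a PROJECTIVE `S`-scheme; `Hilb_{X/S} = ∐_Φ Hilb^{Φ,L}_{X/S}` — countably many proper pieces; this is the content of
Bloch's «simple argument using the Hilbert scheme»); [Markman2026ICMSecant] Thm. 2.1 and the paragraph following (arXiv:2509.23403
v2 p. 6 L59–66); [Hartshorne1977] II §4 p. 103 (projective morphisms) and Cor. 4.8 (e); [StacksProject] Tags 056S, 04XV;
[GrothendieckTopology1969] §1 (coniveau; `Nᶜ Hⁱ = 0` for `i < 2c`); [VoisinHodgeI2002] §11.1.2; [GortzWedhorn2020] Exercise 3.16.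
-/

noncomputable section

open CategoryTheory AlgebraicGeometry Set MonoidalCategory
open Literature.AlgebraicGeometry.HodgeTheory Literature.AlgebraicGeometry.Motives
open Literature.AlgebraicGeometry.Deformation

namespace Summit.Ventures.HSemireg

namespace Bloch1972

/-- **Bloch 1972, Thm. (7.4), GLOBAL over the printed «smooth, connected» base, with the openness half at the OBJECT level:
modulo ONLY `Bloch1972_semiregularSubschemeLifts` ((7.1) + Hilbert point + Artin: an étale-local FLAT family of subschemes through
the semi-regular `Z₀`) and `fulton1998_flatFamily_cycleClass_specialises` (the classes of the fibres of a flat family are the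
restrictions of ONE global class, algebraic on every fibre).** Printed (p. 65): «Let `X →ᶠ S →ᵍ Spec(ℂ)` be morphisms, with `f`
smooth and projective and `g` smooth, connected, and of finite type. Let `z ∈ Γ(S, R^{2p} f_*(Ω•_{X/S}))` be a horizontal section
and let `o ∈ S`. Suppose the restricted class `z₀ ∈ H^{2p}_{DR}(X₀/ℂ)` is algebraic, representing a local complete
intersection, `Z₀ ⊂ X₀` which is semi-regular in `X₀`. Then for all `s ∈ S`, `z_s ∈ H^{2p}_{DR}(X_s/ℂ)` is algebraic.» Proof as
printed: «Hence `Z₀` lifts to an analytic family over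
`U`, so `z_s` is algebraic for `s ∈ U`» = `HeckePrymWeilLine.semiregularSpread_of_blochLifts_of_fulton` (kernel composition of the
two facts: rigidity of flat sections if `z₀ = 0`, else Bloch's lift, Fulton's class, purity on the integral codimension-`p` fibre,
rigidity, descent along the open étale map); «A simple argument using the Hilbert scheme shows `T` […] is contained in a countable
union of closed subvarieties of `S`. Since `U ⊂ T`, it follows that `T = S`» = the tree theorem
`charlesSchnell_algebraicityLocus_iUnion_closed_holds` + Baire over the irreducible base
(`….forall_mem_algebraicClasses_of_isOpen`), irreducibility from «smooth, connected» (regular local rings are domains; a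
connected locally Noetherian scheme with integral local rings is irreducible). RENDERING: `f : 𝒳 ⟶ S` smooth projective of
relative dimension `n` AND projective in Hartshorne's sense (`hproj`: a closed immersion `𝒳 ↪ ℙᴺ × S` over `S`), `𝒳`, `S`
quasi-projective, `S` smooth, CONNECTED; `s₀ ∈ S(ℂ)`; `i₀ : Z₀ ↪ 𝒳_{s₀}` a closed subscheme, INTEGRAL, a local complete
intersection (conormal sheaf finite locally free) of codimension exactly `p` (`≥ p` at every point, `= p` at some point),
Bloch-semiregular (`IsBlochSemiregular i₀ n p`); `W ∈ H²ᵖ(𝒳(ℂ); ℂ)` with fibre restrictions of type `(p,p)` («horizontal»), `W|_{𝒳_{s₀}}`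
supported on `Z₀` («`z₀` algebraic, representing `Z₀`» — the supported-on rendering is mildly MORE GENERAL than print's
`z₀ = [Z₀]`: a class supported on the integral codimension-`p` `Z₀` is `λ·[Z₀]` by purity, `λ = 0` being the rigidity branch of the
kernel; s4-ref P-3); CONCLUSION: `W|_{𝒳_t} ∈ algebraicClasses (𝒳_t) p` for EVERY `t ∈ S(ℂ)`.
Trust base: exactly `hBl`, `hFu`. [cite: Bloch1972Semiregularity, Thm. (7.4) p. 65 L9–14, proof L15–22; Thm. (7.1) p. 64]
[cite: Artin1969, Cor. (2.2)] [cite: Fulton1998, §10.1 Cor. 10.1; §19.1 Lemma 19.1.1; §19.2 Cor. 19.2 (b)]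
[cite: CharlesSchnell2014Notes, Prop. 11.3.11 (proof)] [cite: Voisin2016HodgeConjectureSurvey, §4.2, Thm. 6 and the following paragraph]
[cite: Nitsure2005, Thm. 5.1 (Grothendieck: each Hilb^{Φ,L}_{X/S}, Φ a fixed Hilbert polynomial, is a projective S-scheme; Hilb_{X/S} is their disjoint union over the countably many Φ, §1)]
[cite: Markman2026ICMSecant, Thm. 2.1 and the paragraph following (arXiv:2509.23403 v2 p. 6 L59–66)]
[cite: StacksProject, Tag 056S] [cite: GortzWedhorn2020, Exercise 3.16 (p. 117)] -/
theorem theorem74_connected_of_blochLifts_of_fulton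
    (hBl : Bloch1972_semiregularSubschemeLifts) (hFu : fulton1998_flatFamily_cycleClass_specialises)
    -- «`f` smooth and projective», «`g` smooth, connected, and of finite type»
    {𝒳 S : SchemeOver ℂ} (f : 𝒳 ⟶ S) (n p : ℕ) (hf : IsSmoothProjectiveFamily f n)
    (hproj : ∃ (N : ℕ) (ε : 𝒳 ⟶ projectiveSpace N ℂ ⊗ S), IsClosedImmersion ε.left ∧
      ε ≫ CartesianMonoidalCategory.snd (projectiveSpace N ℂ) S = f)
    (h𝒳 : IsQuasiProjectiveOver 𝒳) (hS : IsQuasiProjectiveOver S) (hSm : AlgebraicGeometry.Smooth S.hom)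
    [ConnectedSpace S.left]
    -- «let `o ∈ S`», «a local complete intersection `Z₀ ⊂ X₀`» of codimension `p`, integral, «semi-regular in `X₀`»
    (s₀ : ComplexPoints S) (Z₀ : Scheme) (i₀ : Z₀ ⟶ (fiberOver f s₀).left)
    (hi₀ : IsClosedImmersion i₀) (hlci : IsFiniteLocallyFree (conormalSheaf i₀))
    (hint : AlgebraicGeometry.IsIntegral Z₀)
    (hcoh : ∀ z : Z₀, (p : ℕ∞) ≤ Order.coheight (i₀.base z))
    (hcohp : ∃ z : Z₀, Order.coheight (i₀.base z) = (p : ℕ∞))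
    (hsr : IsBlochSemiregular i₀ n p)
    -- «`z` a horizontal section» of type `(p,p)` on every fibre, «`z₀` algebraic, representing `Z₀`»
    (W : complexBetti 𝒳 (2 * p))
    (hW : ∀ s : ComplexPoints S,
      IsOfHodgeType n (fiberOver f s) (2 * p) p p (complexBetti.map (fiberι f s) (2 * p) W))
    (hsupp : complexBetti.map (fiberι f s₀) (2 * p) W ∈
      classesSupportedOn (fiberOver f s₀) (Set.range i₀.base) (2 * p))
    -- «Then for all `s ∈ S`, `z_s ∈ H^{2p}_{DR}(X_s/ℂ)` is algebraic.»
    (t : ComplexPoints S) :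
    complexBetti.map (fiberι f t) (2 * p) W ∈ algebraicClasses (fiberOver f t) p := by
  haveI := hSm
  -- «`g` smooth, connected» ⟹ `S` irreducible
  haveI : LocallyOfFiniteType S.hom := inferInstance
  haveI : IsLocallyNoetherian S.left := LocallyOfFiniteType.isLocallyNoetherian S.hom
  haveI : IrreducibleSpace S.left :=
    Literature.AlgebraicGeometry.Motives.irreducibleSpace_of_isDomain_stalk S.left fun x =>
      Literature.AlgebraicGeometry.Resolution.isDomain_stalk_of_smooth S.hom x
  -- «Hence `Z₀` lifts to an analytic family over `U`, so `z_s` is algebraic for `s ∈ U`»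
  obtain ⟨U, hU, hs₀, hUA⟩ :=
    Summit.HodgeConjecture.HodgeConjecture.Theorems.HeckePrymWeilLine.semiregularSpread_of_blochLifts_of_fulton
      hBl hFu f n p hf hproj hSm s₀ Z₀ i₀ hi₀ hlci hint hcoh hcohp hsr W hW hsupp
  -- «`T` […] is contained in a countable union of closed subvarieties of `S`. Since `U ⊂ T`, it follows that `T = S`»
  exact charlesSchnell_algebraicityLocus_iUnion_closed_holds.forall_mem_algebraicClasses_of_isOpen f n p h𝒳 hS hSm
    hf W hU ⟨s₀, hs₀⟩ hUA t

/-- **Bloch 1972, Thm. (7.4), GLOBAL over the printed «smooth, connected» base, openness at the OBJECT level — v2: the binders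
«`f` projective in Hartshorne's sense» and «`Z₀` has a point of codimension exactly `p`» of
`theorem74_connected_of_blochLifts_of_fulton` DISCHARGED.** Same printed statement (p. 65): «Let `X →ᶠ S →ᵍ Spec(ℂ)` be
morphisms, with `f` smooth and projective and `g` smooth, connected, and of finite type. Let `z ∈ Γ(S, R^{2p} f_*(Ω•_{X/S}))` be
a horizontal section and let `o ∈ S`. Suppose the restricted class `z₀ ∈ H^{2p}_{DR}(X₀/ℂ)` is algebraic, representing a local
complete intersection, `Z₀ ⊂ X₀` which is semi-regular in `X₀`. Then for all `s ∈ S`, `z_s ∈ H^{2p}_{DR}(X_s/ℂ)` is algebraic.»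
RENDERING: as in
`theorem74_connected_of_blochLifts_of_fulton` — `f : 𝒳 ⟶ S` a smooth projective family of relative dimension `n` (proper, smooth,
fibres smooth projective), `𝒳` and `S` quasi-projective, `S` smooth CONNECTED; `s₀ ∈ S(ℂ)`; `i₀ : Z₀ ↪ 𝒳_{s₀}` a closed subscheme,
INTEGRAL, a local complete intersection (conormal sheaf finite locally free) all of whose points have codimension `≥ p` in
`X₀ = 𝒳_{s₀}`, Bloch-semiregular; `W ∈ H²ᵖ(𝒳(ℂ); ℂ)` with fibre restrictions of type `(p,p)` and `W|_{X₀}` supported on `Z₀`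
(mildly more general than print's `z₀ = [Z₀]`, as above); CONCLUSION `W|_{𝒳_t} ∈ algebraicClasses (𝒳_t) p` for EVERY `t ∈ S(ℂ)` —
but WITHOUT the two extra binders of v1: (a) «`f` projective» (a closed `S`-immersion `𝒳 ↪ ℙᴺ × S`) is DERIVED from «`𝒳`
quasi-projective, `f` proper»: `(j ≫ κ, f) : 𝒳 ⟶ ℙᴺ ⊗ S` (`j : 𝒳 ↪ P` open, `κ : P ↪ ℙᴺ` closed) is a proper monomorphism, hence
a closed immersion (Hartshorne II §4 p. 103 and Cor. 4.8 (e); Stacks 04XV; tree theorem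
`IsQuasiProjectiveOver.exists_isClosedImmersion_projectiveSpace_tensor`); (b) «codimension exactly `p`»: EITHER some point of
`Z₀` has codimension `p` — then v1's kernel `HeckePrymWeilLine.semiregularSpread_of_blochLifts_of_fulton` (Bloch's lift, Fulton's
class, purity, rigidity, descent) gives an open `U ∋ s₀` of `S(ℂ)` over which `W` is algebraic — OR every point of `Z₀` has
codimension `≥ p + 1`, and then `W|_{X₀} ∈ H^{2p}_{Z₀}(X₀) ⊆ N^{p+1} H^{2p}(X₀(ℂ); ℂ) = 0` (semipurity of the coniveau filtration:
Grothendieck 1969 §1, Voisin I §11.1.2; tree theorems `classesSupportedOn_le_supportedClasses`, `supportedClasses_eq_bot_of_lt`),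
so the flat section `s ↦ W|_{𝒳_s}` (Ehresmann, `isCohomologicallyLocallyTrivialOn_univ_of_isSmoothProjectiveFamily_of_smooth`)
vanishes on an open `U ∋ s₀` (`isOpen_setOf_map_fiberι_eq_zero`), where `0` is algebraic. In both cases «`T` […] is contained in
a countable union of closed subvarieties of `S`. Since `U ⊂ T`, it follows that `T = S`» (tree theorem
`charlesSchnell_algebraicityLocus_iUnion_closed_holds` + Baire over the irreducible base; «smooth, connected» ⟹ irreducible).
WHAT STILL SEPARATES this from discharging the class-level named fact `BlochSemiregularSpread n p` (integral seeds) from the two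
object-level facts: the model isomorphism `e : X₀ ≅ 𝒳_{s₀}` of that fact (transport of `IsBlochSemiregular` along an isomorphism
of ambient schemes) and its lci rendering `IsRegularImmersionOfCodim i p` (⟹ conormal sheaf finite locally free, Görtz–Wedhorn II
Rem. 19.22) — neither transport is in the tree (the binder-list comparison is this file's; that the kernel composition consumes
nothing else is s4-ref's route-side audit, VERDICT-B1-OBJECTLEVEL §2). Trust base: exactly `hBl`, `hFu`.
[cite: Bloch1972Semiregularity, Thm. (7.4) p. 65 L9–14, proof L15–22; Thm. (7.1) p. 64]
[cite: Artin1969, Cor. (2.2)] [cite: Fulton1998, §10.1 Cor. 10.1; §19.1 Lemma 19.1.1; §19.2 Cor. 19.2 (b)]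
[cite: Hartshorne1977, II §4 (p. 103, projective morphisms) and Cor. 4.8 (e)] [cite: StacksProject, Tags 04XV and 056S]
[cite: GrothendieckTopology1969, §1 (coniveau filtration; N^c H^i = 0 for i < 2c)] [cite: VoisinHodgeI2002, §11.1.2 (Lemma 11.13)]
[cite: VoisinHodgeII2003, §3.1.2 (flat sections)] [cite: CharlesSchnell2014Notes, Prop. 11.3.11 (proof)]
[cite: Nitsure2005, Thm. 5.1 and §1 (Hilb^{Φ,L}_{X/S} projective over S for each Hilbert polynomial Φ)]
[cite: Markman2026ICMSecant, Thm. 2.1 and the paragraph following (arXiv:2509.23403 v2 p. 6 L59–66)] -/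
theorem theorem74_connected_of_blochLifts_of_fulton'
    (hBl : Bloch1972_semiregularSubschemeLifts) (hFu : fulton1998_flatFamily_cycleClass_specialises)
    -- «`f` smooth and projective» (proper; with `𝒳` quasi-projective this IS Hartshorne-projective), «`g` smooth, connected»
    {𝒳 S : SchemeOver ℂ} (f : 𝒳 ⟶ S) (n p : ℕ) (hf : IsSmoothProjectiveFamily f n)
    (h𝒳 : IsQuasiProjectiveOver 𝒳) (hS : IsQuasiProjectiveOver S) (hSm : AlgebraicGeometry.Smooth S.hom)
    [ConnectedSpace S.left]
    -- «let `o ∈ S`», «a local complete intersection `Z₀ ⊂ X₀` of codimension `p`», integral, «semi-regular in `X₀`»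
    (s₀ : ComplexPoints S) (Z₀ : Scheme) (i₀ : Z₀ ⟶ (fiberOver f s₀).left)
    (hi₀ : IsClosedImmersion i₀) (hlci : IsFiniteLocallyFree (conormalSheaf i₀))
    (hint : AlgebraicGeometry.IsIntegral Z₀)
    (hcoh : ∀ z : Z₀, (p : ℕ∞) ≤ Order.coheight (i₀.base z))
    (hsr : IsBlochSemiregular i₀ n p)
    -- «`z` a horizontal section» of type `(p,p)` on every fibre, «`z₀` algebraic, representing `Z₀`»
    (W : complexBetti 𝒳 (2 * p))
    (hW : ∀ s : ComplexPoints S,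
      IsOfHodgeType n (fiberOver f s) (2 * p) p p (complexBetti.map (fiberι f s) (2 * p) W))
    (hsupp : complexBetti.map (fiberι f s₀) (2 * p) W ∈
      classesSupportedOn (fiberOver f s₀) (Set.range i₀.base) (2 * p))
    -- «Then for all `s ∈ S`, `z_s ∈ H^{2p}_{DR}(X_s/ℂ)` is algebraic.»
    (t : ComplexPoints S) :
    complexBetti.map (fiberι f t) (2 * p) W ∈ algebraicClasses (fiberOver f t) p := by
  haveI := hSm
  -- «`g` smooth, connected» ⟹ `S` irreducible
  haveI : LocallyOfFiniteType S.hom := inferInstance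
  haveI : IsLocallyNoetherian S.left := LocallyOfFiniteType.isLocallyNoetherian S.hom
  haveI : IrreducibleSpace S.left :=
    Literature.AlgebraicGeometry.Motives.irreducibleSpace_of_isDomain_stalk S.left fun x =>
      Literature.AlgebraicGeometry.Resolution.isDomain_stalk_of_smooth S.hom x
  -- «`f` smooth and projective»: `𝒳` quasi-projective and `f` proper give the closed `S`-immersion `𝒳 ↪ ℙᴺ × S`
  have hproj : ∃ (N : ℕ) (ε : 𝒳 ⟶ projectiveSpace N ℂ ⊗ S), IsClosedImmersion ε.left ∧
      ε ≫ CartesianMonoidalCategory.snd (projectiveSpace N ℂ) S = f :=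
    h𝒳.exists_isClosedImmersion_projectiveSpace_tensor_of_isSmoothProjectiveFamily f hf
  -- «so `z_s` is algebraic for `s ∈ U`»: an open `U ∋ s₀` of `S(ℂ)` over which `W` is algebraic
  have hloc : ∃ U : Set (ComplexPoints S), IsOpen U ∧ s₀ ∈ U ∧
      ∀ t ∈ U, complexBetti.map (fiberι f t) (2 * p) W ∈ algebraicClasses (fiberOver f t) p := by
    by_cases hcohp : ∃ z : Z₀, Order.coheight (i₀.base z) = (p : ℕ∞)
    · -- codimension exactly `p` somewhere: Bloch's lift + Fulton's class (the kernel composition of v1)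
      exact Summit.HodgeConjecture.HodgeConjecture.Theorems.HeckePrymWeilLine.semiregularSpread_of_blochLifts_of_fulton
        hBl hFu f n p hf hproj hSm s₀ Z₀ i₀ hi₀ hlci hint hcoh hcohp hsr W hW hsupp
    · -- codimension `≥ p + 1` everywhere: `W|_{X₀} ∈ N^{p+1} H^{2p} = 0` (semipurity), and the flat section vanishes near `s₀`
      push Not at hcohp
      haveI := hi₀
      have hcoh' : ∀ z ∈ Set.range i₀.base, ((p + 1 : ℕ) : ℕ∞) ≤ Order.coheight z := by
        rintro _ ⟨z, rfl⟩
        rw [Nat.cast_add_one]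
        exact Order.add_one_le_of_lt (lt_of_le_of_ne (hcoh z) (Ne.symm (hcohp z)))
      have hW0 : complexBetti.map (fiberι f s₀) (2 * p) W = 0 := by
        have h := classesSupportedOn_le_supportedClasses i₀.isClosedEmbedding.isClosed_range hcoh'
          (2 * p) hsupp
        rw [supportedClasses_eq_bot_of_lt (hf.isSmoothProjective s₀)
          (show 2 * p < 2 * (p + 1) by omega)] at h
        exact (Submodule.mem_bot ℂ).1 h
      have hE := isCohomologicallyLocallyTrivialOn_univ_of_isSmoothProjectiveFamily_of_smooth f hf
      refine ⟨{s | s ∈ Set.univ ∧ complexBetti.map (fiberι f s) (2 * p) W = 0},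
        isOpen_setOf_map_fiberι_eq_zero hE W, ⟨Set.mem_univ _, hW0⟩, fun t ht ↦ ?_⟩
      rw [ht.2]
      exact Submodule.zero_mem _
  -- «`T` […] is contained in a countable union of closed subvarieties of `S`. Since `U ⊂ T`, it follows that `T = S`»
  obtain ⟨U, hU, hs₀, hUA⟩ := hloc
  exact charlesSchnell_algebraicityLocus_iUnion_closed_holds.forall_mem_algebraicClasses_of_isOpen f n p h𝒳 hS hSm
    hf W hU ⟨s₀, hs₀⟩ hUA t

/-- **Bloch 1972, Thm. (7.4), GLOBAL over the printed «smooth, connected» base, openness at the OBJECT level — v4: the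
local-complete-intersection seed given by `IsRegularImmersionOfCodim i₀ p` (the lci predicate of the class-level named fact
`BlochSemiregularSpread n p`).** Same printed statement (p. 65): «Let `X →ᶠ S →ᵍ Spec(ℂ)` be morphisms, with `f` smooth and
projective and `g` smooth, connected, and of finite type. Let `z ∈ Γ(S, R^{2p} f_*(Ω•_{X/S}))` be a horizontal section and let
`o ∈ S`. Suppose the restricted class `z₀ ∈ H^{2p}_{DR}(X₀/ℂ)` is algebraic, representing a local complete intersection,
`Z₀ ⊂ X₀` which is semi-regular in `X₀`. Then for all `s ∈ S`, `z_s ∈ H^{2p}_{DR}(X_s/ℂ)` is algebraic.» RENDERING: as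
`theorem74_connected_of_blochLifts_of_fulton'`, except that «a local complete intersection `Z₀ ⊂ X₀`» of codimension `p` is
now the SINGLE binder `IsRegularImmersionOfCodim i₀ p` (a closed immersion whose ideal is generated, on an affine open
neighbourhood of each point of the image, by a weakly regular sequence of length `p` — Görtz–Wedhorn II Def. 19.19/19.23,
Bloch p. 51 «a subscheme of codimension `p` which is a local complete intersection»), from which v2's binders are derived:
`IsClosedImmersion i₀` (`.isClosedImmersion`), `IsFiniteLocallyFree (conormalSheaf i₀)`
(`.isFiniteLocallyFree_conormalSheaf`, GW II Rem. 19.22) and `∀ z, p ≤ coheight (i₀ z)` (`.le_coheight`, Bruns–Herzog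
Prop. 1.2.12/1.2.14), the fibre `𝒳_{s₀}` being locally Noetherian (smooth projective over `ℂ`). Remaining binders: `Z₀`
INTEGRAL, Bloch-semiregular; `W` a global class of fibrewise type `(p,p)` with `W|_{X₀}` supported on `Z₀`; `f` a smooth
projective family, `𝒳`, `S` quasi-projective, `S` smooth connected. Trust base: exactly `hBl`, `hFu`.
[cite: Bloch1972Semiregularity, Thm. (7.4) p. 65 L9–14, proof L15–22; Thm. (7.1) p. 64; §0 p. 51]
[cite: GortzWedhorn2023, Def. 19.19, Def. 19.23 and Rem. 19.22] [cite: BrunsHerzog1998, §1.2 Prop. 1.2.12 and Prop. 1.2.14]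
[cite: Artin1969, Cor. (2.2)] [cite: Fulton1998, §10.1 Cor. 10.1; §19.1 Lemma 19.1.1; §19.2 Cor. 19.2 (b)]
[cite: CharlesSchnell2014Notes, Prop. 11.3.11 (proof)] [cite: Hartshorne1977, II §4 (p. 103) and Cor. 4.8 (e)]
[cite: GrothendieckTopology1969, §1 (N^c H^i = 0 for i < 2c)] -/
theorem theorem74_connected_of_blochLifts_of_fulton''
    (hBl : Bloch1972_semiregularSubschemeLifts) (hFu : fulton1998_flatFamily_cycleClass_specialises)
    -- «`f` smooth and projective», «`g` smooth, connected, and of finite type»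
    {𝒳 S : SchemeOver ℂ} (f : 𝒳 ⟶ S) (n p : ℕ) (hf : IsSmoothProjectiveFamily f n)
    (h𝒳 : IsQuasiProjectiveOver 𝒳) (hS : IsQuasiProjectiveOver S) (hSm : AlgebraicGeometry.Smooth S.hom)
    [ConnectedSpace S.left]
    -- «let `o ∈ S`», «a local complete intersection `Z₀ ⊂ X₀`» of codimension `p` (ONE binder), integral, semi-regular
    (s₀ : ComplexPoints S) (Z₀ : Scheme) (i₀ : Z₀ ⟶ (fiberOver f s₀).left)
    (hreg : IsRegularImmersionOfCodim i₀ p) (hint : AlgebraicGeometry.IsIntegral Z₀)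
    (hsr : IsBlochSemiregular i₀ n p)
    -- «`z` a horizontal section» of type `(p,p)` on every fibre, «`z₀` algebraic, representing `Z₀`»
    (W : complexBetti 𝒳 (2 * p))
    (hW : ∀ s : ComplexPoints S,
      IsOfHodgeType n (fiberOver f s) (2 * p) p p (complexBetti.map (fiberι f s) (2 * p) W))
    (hsupp : complexBetti.map (fiberι f s₀) (2 * p) W ∈
      classesSupportedOn (fiberOver f s₀) (Set.range i₀.base) (2 * p))
    -- «Then for all `s ∈ S`, `z_s ∈ H^{2p}_{DR}(X_s/ℂ)` is algebraic.»
    (t : ComplexPoints S) :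
    complexBetti.map (fiberι f t) (2 * p) W ∈ algebraicClasses (fiberOver f t) p := by
  -- the fibre `X₀ = 𝒳_{s₀}` is smooth projective, hence locally Noetherian
  haveI : IsLocallyNoetherian (fiberOver f s₀).left :=
    IsSmoothProjective.isLocallyNoetherian_holds (hf.isSmoothProjective s₀)
  exact theorem74_connected_of_blochLifts_of_fulton' hBl hFu f n p hf h𝒳 hS hSm s₀ Z₀ i₀ hreg.isClosedImmersion
    (hreg.isFiniteLocallyFree_conormalSheaf i₀) hint hreg.le_coheight hsr W hW hsupp t

end Bloch1972

end Summit.Ventures.HSemireg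

end
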